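import Mathlib
import HarnessLib

/-!
# Twisted Euler derivations and the Jacobian criterion for the slice

Topic: `Summits/ResolutionOfSingularities/ResolutionOfSingularities/Theorems`. Helper file of the
stub `stub_quotientSingularities_of_regular` of the line `Sketch` of the crux
`Theses.WeightedInvariant.DatumToEmbedded` (statement `stmt-ResolutionOfSingularities-0572`).

Part 1 (twisted Euler derivations). Let `R = ⨁_χ R_χ` be a commutative `k`-algebra graded by an
abelian group `G`, `M ≤ G` a subgroup, `n : M → ℤ` additive, and `τ : R → K` a `k`-algebra map
to a commutative `k`-algebra killing every `R_χ` with `χ ∉ M` (e.g. evaluation at a point of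
`Spec R` along whose torus orbit exactly the degrees in `M` survive). The **twisted Euler map**
`E(r) := ∑_{χ ∈ M} n(χ) · τ(r_χ)` (`eulerMap`; the weight `n`, extended by `0` outside `M`, is
`weight`) is `k`-linear and satisfies Leibniz' rule `E(r s) = τ(r) E(s) + τ(s) E(r)`
(`eulerMap_mul`) — it is the composite of the coaction `R → R ⊗ k[M]` evaluated at the point
with the invariant derivation `z^χ ↦ n(χ) z^χ` of the torus `Spec k[M]`; note that `n` need NOT
extend to `G` (the point of using the lattice `M` rather than `G` in positive characteristic).
For a commutative `k`-algebra `κ` and a `κ ⊗ₖ R`-algebra `K`, such an `E` (for `τ = (r ↦ 1 ⊗ r)`)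
extends to the `k`-derivation `c ⊗ r ↦ c · E(r)` of `κ ⊗ₖ R` into `K` (`tensorDerivation`).

Part 2 (the Jacobian criterion).
* `isSmoothAt_of_derivation` — **Jacobian criterion at a prime, tested by derivations.** Let
  `P₀` be a smooth `k`-algebra, `g₁, …, gₘ ∈ P₀`, `S = P₀ ⧸ (g)`, `𝔶` a prime of `S` with
  preimage `𝔮 ⊂ P₀`. If there are `k`-derivations `D₁, …, Dₘ : P₀ → κ(𝔮)` with `Dₗ(gᵢ) = 0`
  for `l ≠ i` and `Dᵢ(gᵢ) ≠ 0`, then `S` is smooth over `k` at `𝔶`. Proof: Mathlib's Jacobian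
  criterion for local algebras (`Algebra.FormallySmooth.iff_injective_cotangentComplexBaseChange`,
  Stacks 00TB/07CF) applied to the presentation `(P₀)_𝔮 ↠ (P₀)_𝔮 ⧸ (g) ≅ S_𝔶`: the source
  `κ(𝔮) ⊗ (g)` of the cotangent map is spanned by the classes of the `gᵢ`, whose images
  `1 ⊗ dgᵢ ∈ κ(𝔮) ⊗ Ω[(P₀)_𝔮 ⁄ k] = κ(𝔮) ⊗ Ω[P₀ ⁄ k]` are linearly independent because the
  functionals induced by the `Dₗ` separate them.
* `isSmoothAt_slice` — for a graded `k`-algebra `R = ⨁_χ R_χ` with homogeneous units `uₗ` whose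
  degrees form a `ℤ`-basis of a lattice `M`, constants `cₗ` in a `k`-algebra `κ`, and the SLICE
  `S = (κ ⊗ₖ R) ⧸ (1 ⊗ uₗ - cₗ ⊗ 1)ₗ` (the fibre of `Spec R → Spec k[M]` over a `κ`-point), `S`
  is smooth over `k` at every prime `𝔶` containing the `1 ⊗ R_χ`, `χ ∉ M` (the points whose
  orbit has character lattice exactly `M`), as soon as `κ ⊗ₖ R` is smooth over `k`: the twisted
  Euler derivations with weights the coordinates in the basis of `M` have
  `Dₗ(1 ⊗ uᵢ - cᵢ ⊗ 1) = δₗᵢ · uᵢ(𝔶)`. [folklore: Luna's étale slice for a diagonalizable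
  group, fibre form]

Only Mathlib is used.
-/

-- the summit namespace repeats `ResolutionOfSingularities` by design (mandated namespace)
set_option linter.dupNamespace false

namespace Summit.ResolutionOfSingularities.ResolutionOfSingularities.Theorems.DatumToEmbedded.QuotientSingularities


open DirectSum TensorProduct

/-! ## The weight -/

section Weight

variable {G : Type*} [AddCommGroup G] (M : Submodule ℤ G) (n : M →+ ℤ)

/-- The weight `n` on `M`, extended by zero outside `M`. [folklore] -/
noncomputable def weight (χ : G) : ℤ :=
  by classical exact if h : χ ∈ M then n ⟨χ, h⟩ else 0

/-- The weight on `M`. [folklore] -/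
theorem weight_of_mem {χ : G} (h : χ ∈ M) : weight M n χ = n ⟨χ, h⟩ := by
  classical
  exact dif_pos h

/-- The weight outside `M`. [folklore] -/
theorem weight_of_not_mem {χ : G} (h : χ ∉ M) : weight M n χ = 0 := by
  classical
  exact dif_neg h

/-- The weight of `0` is `0`. [folklore] -/
theorem weight_zero : weight M n 0 = 0 := by
  rw [weight_of_mem M n M.zero_mem]
  exact map_zero n

/-- The weight is additive on `M`. [folklore] -/
theorem weight_add {χ ψ : G} (hχ : χ ∈ M) (hψ : ψ ∈ M) :
    weight M n (χ + ψ) = weight M n χ + weight M n ψ := by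
  rw [weight_of_mem M n hχ, weight_of_mem M n hψ, weight_of_mem M n (M.add_mem hχ hψ), ← map_add]
  rfl

end Weight

/-! ## The twisted Euler map -/

section Euler

variable {k R K G : Type*} [CommRing k] [CommRing R] [Algebra k R] [CommRing K] [Algebra k K]
  [AddCommGroup G] [DecidableEq G] (𝓡 : G → Submodule k R) [GradedAlgebra 𝓡]
  (M : Submodule ℤ G) (n : M →+ ℤ) (τ : R →ₐ[k] K)

/-- The **twisted Euler map** `E(r) = ∑_χ weight(χ) · τ(r_χ)`. [folklore] -/
noncomputable def eulerMap : R →ₗ[k] K :=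
  (DirectSum.toModule k G K fun χ => weight M n χ • (τ.toLinearMap ∘ₗ (𝓡 χ).subtype)) ∘ₗ
    (DirectSum.decomposeLinearEquiv 𝓡).toLinearMap

/-- The twisted Euler map on a homogeneous element of degree `χ` is `weight(χ) · τ`. [folklore] -/
theorem eulerMap_of_mem {χ : G} {r : R} (hr : r ∈ 𝓡 χ) :
    eulerMap 𝓡 M n τ r = weight M n χ • τ r := by
  have h1 : (DirectSum.decomposeLinearEquiv 𝓡).toLinearMap r =
      DirectSum.lof k G (fun χ => 𝓡 χ) χ ⟨r, hr⟩ := by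
    rw [DirectSum.lof_eq_of]
    exact decompose_of_mem 𝓡 hr
  rw [eulerMap, LinearMap.comp_apply, h1, DirectSum.toModule_lof]
  rfl

/-- The twisted Euler map kills `1`. [folklore] -/
theorem eulerMap_one : eulerMap 𝓡 M n τ 1 = 0 := by
  rw [eulerMap_of_mem 𝓡 M n τ (SetLike.one_mem_graded 𝓡), weight_zero, zero_smul]

/-- **Leibniz' rule for the twisted Euler map**, provided `τ` kills the pieces of degree outside
`M`: `E(r s) = τ(r) E(s) + τ(s) E(r)`. [folklore] -/
theorem eulerMap_mul (hτ : ∀ χ ∉ M, ∀ r ∈ 𝓡 χ, τ r = 0) (r s : R) :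
    eulerMap 𝓡 M n τ (r * s) = τ r * eulerMap 𝓡 M n τ s + τ s * eulerMap 𝓡 M n τ r := by
  induction r using DirectSum.Decomposition.inductionOn 𝓡 generalizing s with
  | zero => simp
  | add r r' hr hr' => rw [add_mul, map_add, hr, hr', map_add, map_add]; ring
  | homogeneous r =>
    obtain ⟨r, hrm⟩ := r
    induction s using DirectSum.Decomposition.inductionOn 𝓡 with
    | zero => simp
    | add s s' hs hs' => rw [mul_add, map_add, hs, hs', map_add, map_add]; ring
    | homogeneous s =>
      obtain ⟨s, hsm⟩ := s
      rename_i ψ ψ'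
      dsimp only
      rw [eulerMap_of_mem 𝓡 M n τ (SetLike.mul_mem_graded hrm hsm), eulerMap_of_mem 𝓡 M n τ hrm,
        eulerMap_of_mem 𝓡 M n τ hsm, map_mul]
      by_cases hψ : ψ ∈ M
      · by_cases hψ' : ψ' ∈ M
        · rw [weight_add M n hψ hψ', add_smul, mul_smul_comm, mul_smul_comm, mul_comm (τ s) (τ r)]
          abel
        · rw [hτ ψ' hψ' s hsm, weight_of_not_mem M n hψ']
          simp
      · rw [hτ ψ hψ r hrm, weight_of_not_mem M n hψ]
        simp

end Euler

/-! ## Extension to `κ ⊗ₖ R` -/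

section Tensor

variable {k R K κ : Type*} [CommRing k] [CommRing R] [Algebra k R] [CommRing K]
  [CommRing κ] [Algebra k κ] [Algebra (κ ⊗[k] R) K] [Algebra k K] [IsScalarTower k (κ ⊗[k] R) K]

variable (k R K κ) in
/-- The structure map restricted to the left factor `κ`. [folklore] -/
noncomputable def leftMap : κ →ₐ[k] K :=
  (IsScalarTower.toAlgHom k (κ ⊗[k] R) K).comp Algebra.TensorProduct.includeLeft

variable (k R K κ) in
/-- The structure map restricted to the right factor `R`. [folklore] -/
noncomputable def rightMap : R →ₐ[k] K :=
  (IsScalarTower.toAlgHom k (κ ⊗[k] R) K).comp Algebra.TensorProduct.includeRight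

/-- The structure map on a pure tensor. [folklore] -/
theorem algebraMap_tmul (c : κ) (r : R) :
    algebraMap (κ ⊗[k] R) K (c ⊗ₜ r) = leftMap k R K κ c * rightMap k R K κ r := by
  rw [show c ⊗ₜ[k] r = (c ⊗ₜ[k] (1 : R)) * ((1 : κ) ⊗ₜ[k] r) by
    rw [Algebra.TensorProduct.tmul_mul_tmul, mul_one, one_mul], map_mul]
  rfl

variable (E : R →ₗ[k] K) (hE1 : E 1 = 0)
  (hE : ∀ r s, E (r * s) = rightMap k R K κ r * E s + rightMap k R K κ s * E r)

/-- **The derivation `c ⊗ r ↦ c · E(r)` of `κ ⊗ₖ R`** extending a `k`-linear map `E : R → K`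
that kills `1` and satisfies Leibniz' rule along `r ↦ 1 ⊗ r`. [folklore] -/
noncomputable def tensorDerivation : Derivation k (κ ⊗[k] R) K where
  toLinearMap := TensorProduct.lift ((LinearMap.mul k K).compl₁₂ (leftMap k R K κ).toLinearMap E)
  map_one_eq_zero' := by
    rw [Algebra.TensorProduct.one_def]
    simp [hE1]
  leibniz' a b := by
    simp only [Algebra.smul_def]
    induction a using TensorProduct.induction_on with
    | zero => simp
    | add x y hx hy => simp only [add_mul, map_add, hx, hy]; ring
    | tmul c r =>
      induction b using TensorProduct.induction_on with
      | zero => simp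
      | add x y hx hy => simp only [mul_add, map_add, hx, hy]; ring
      | tmul c' r' =>
        simp only [Algebra.TensorProduct.tmul_mul_tmul, TensorProduct.lift.tmul,
          LinearMap.compl₁₂_apply, AlgHom.toLinearMap_apply, LinearMap.mul_apply', map_mul,
          algebraMap_tmul, hE]
        ring

/-- The derivation on a pure tensor. [folklore] -/
theorem tensorDerivation_tmul (c : κ) (r : R) :
    tensorDerivation E hE1 hE (c ⊗ₜ r) = leftMap k R K κ c * E r := by
  change TensorProduct.lift _ (c ⊗ₜ r) = _
  rw [TensorProduct.lift.tmul]
  rfl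

/-- The derivation on `1 ⊗ u - c ⊗ 1` is `E u`. [folklore] -/
theorem tensorDerivation_sub (c : κ) (u : R) :
    tensorDerivation E hE1 hE ((1 : κ) ⊗ₜ u - c ⊗ₜ (1 : R)) = E u := by
  rw [map_sub, tensorDerivation_tmul, tensorDerivation_tmul, hE1, mul_zero, sub_zero, map_one,
    one_mul]

end Tensor


open TensorProduct

/-! ## The Jacobian criterion at a prime, via derivations -/

section Jacobian

/-- **Jacobian criterion at a prime, tested by derivations**: if `P₀` is a smooth `k`-algebra,
`S = P₀ ⧸ (g₁, …, gₘ)`, `𝔶 ⊂ S` a prime with preimage `𝔮 ⊂ P₀`, and `k`-derivations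
`Dₗ : P₀ → κ(𝔮)` satisfy `Dₗ(gᵢ) = 0` (`l ≠ i`), `Dᵢ(gᵢ) ≠ 0`, then `S` is smooth over `k` at
`𝔶`. [folklore; Stacks 00TB] -/
theorem isSmoothAt_of_derivation
    {k P₀ : Type*} [Field k] [CommRing P₀] [Algebra k P₀] [Algebra.Smooth k P₀]
    {m : ℕ} (g : Fin m → P₀) (𝔶 : Ideal (P₀ ⧸ Ideal.span (Set.range g))) [𝔶.IsPrime]
    (D : Fin m → Derivation k P₀ (𝔶.comap (Ideal.Quotient.mk _)).ResidueField)
    (hD : ∀ l i, l ≠ i → D l (g i) = 0) (hD' : ∀ i, D i (g i) ≠ 0) :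
    Algebra.IsSmoothAt k 𝔶 := by
  let I := Ideal.span (Set.range g)
  let 𝔮 := 𝔶.comap (Ideal.Quotient.mk I)
  haveI h𝔮 : 𝔮.IsPrime := Ideal.comap_isPrime _ _
  let P := Localization.AtPrime 𝔮
  let K := 𝔮.ResidueField
  let I' : Ideal P := I.map (algebraMap P₀ P)
  let Sₗ := P ⧸ I'
  have hI𝔮 : I ≤ 𝔮 := fun x hx =>
    Ideal.mem_comap.2 (by rw [Ideal.Quotient.eq_zero_iff_mem.2 hx]; exact zero_mem _)
  have hI' : I' ≤ IsLocalRing.maximalIdeal P := by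
    rw [← Localization.AtPrime.map_eq_maximalIdeal]; exact Ideal.map_mono hI𝔮
  have hI'top : I' ≠ ⊤ := fun h =>
    (IsLocalRing.maximalIdeal.isMaximal P).ne_top (top_le_iff.1 (h ▸ hI'))
  haveI : Nontrivial Sₗ := Ideal.Quotient.nontrivial_iff.2 hI'top
  haveI : IsLocalRing Sₗ := .of_surjective' (Ideal.Quotient.mk I') Ideal.Quotient.mk_surjective
  -- `K` as an `Sₗ`-algebra
  have hker : ∀ a ∈ I', algebraMap P K a = 0 := fun a ha =>
    (IsLocalRing.residue_eq_zero_iff _).2 (hI' ha)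
  letI : Algebra Sₗ K := (Ideal.Quotient.lift I' (algebraMap P K) hker).toAlgebra
  haveI hT := IsScalarTower.of_algebraMap_eq (R := P) (S := Sₗ) (A := K) fun x => rfl
  -- formal smoothness of `P` and finiteness/freeness of its differentials
  haveI : Algebra.FormallySmooth k P := .comp k P₀ P
  let e := KaehlerDifferential.tensorKaehlerEquivOfFormallyEtale k P₀ P
  haveI : Module.Finite P Ω[P⁄k] := Module.Finite.of_surjective e.toLinearMap e.surjective
  haveI : Module.Projective P Ω[P⁄k] := Algebra.FormallySmooth.projective_kaehlerDifferential
  haveI : Module.Free P Ω[P⁄k] := Module.free_of_flat_of_isLocalRing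
  have h₁ : Function.Surjective (algebraMap P Sₗ) := Ideal.Quotient.mk_surjective
  have hkerI' : RingHom.ker (algebraMap P Sₗ) = I' := by
    rw [Ideal.Quotient.algebraMap_eq, Ideal.mk_ker]
  have h₂ : (RingHom.ker (algebraMap P Sₗ)).FG := by
    rw [hkerI']
    exact Ideal.FG.map ⟨(Set.finite_range g).toFinset, by simp [I]⟩ _
  have h₃ : IsLocalRing.maximalIdeal Sₗ ≤ RingHom.ker (algebraMap Sₗ K) := by
    intro x hx
    obtain ⟨p, rfl⟩ := Ideal.Quotient.mk_surjective x
    have hp : p ∈ IsLocalRing.maximalIdeal P := fun hp => hx (hp.map (Ideal.Quotient.mk I'))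
    exact (IsLocalRing.residue_eq_zero_iff _).2 hp
  have key := Algebra.FormallySmooth.iff_injective_cotangentComplexBaseChange (R := k) (S := Sₗ)
    P K h₁ h₂ h₃
  -- smoothness of the local ring `Sₗ`
  have hSₗ : Algebra.FormallySmooth k Sₗ := by
    rw [key]
    -- the functionals `ψ l : K ⊗ Ω[P/k] → K` induced by the derivations `D l`
    let ψ : Fin m → (K ⊗[P] Ω[P⁄k] →ₗ[K] K) := fun l =>
      LinearMap.liftBaseChange K
        ((LinearMap.liftBaseChange P (D l).liftKaehlerDifferential) ∘ₗ e.symm.toLinearMap)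
    have hψ : ∀ l (x : P₀),
        ψ l (1 ⊗ₜ KaehlerDifferential.D k P (algebraMap P₀ P x)) = D l x := by
      intro l x
      have he : e.symm (KaehlerDifferential.D k P (algebraMap P₀ P x)) =
          1 ⊗ₜ KaehlerDifferential.D k P₀ x := by
        rw [LinearEquiv.symm_apply_eq]
        change _ = KaehlerDifferential.mapBaseChange k P₀ P _
        rw [KaehlerDifferential.mapBaseChange_tmul, one_smul, KaehlerDifferential.map_D]
      simp only [ψ, LinearMap.liftBaseChange_tmul, LinearMap.comp_apply, LinearEquiv.coe_coe, he,
        one_smul, Derivation.liftKaehlerDifferential_comp_D]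
    -- the generators of the kernel
    have hmem : ∀ l, algebraMap P₀ P (g l) ∈ RingHom.ker (algebraMap P Sₗ) := fun l => by
      rw [hkerI']
      exact Ideal.mem_map_of_mem _ (Ideal.subset_span ⟨l, rfl⟩)
    let Gk : Fin m → RingHom.ker (algebraMap P Sₗ) := fun l => ⟨_, hmem l⟩
    -- … span `K ⊗ ker`
    have hspan : ∀ z : K ⊗[P] RingHom.ker (algebraMap P Sₗ),
        ∃ c : Fin m → K, ∑ l, c l • ((1 : K) ⊗ₜ[P] Gk l) = z := by
      intro z
      rw [← Submodule.mem_span_range_iff_exists_fun K]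
      induction z using TensorProduct.induction_on with
      | zero => exact zero_mem _
      | add x y hx hy => exact add_mem hx hy
      | tmul c x =>
        have hx : (x : P) ∈ Ideal.span (Set.range fun l => algebraMap P₀ P (g l)) := by
          have hx₀ : (x : P) ∈ Ideal.map (algebraMap P₀ P) (Ideal.span (Set.range g)) :=
            hkerI'.le x.2
          rwa [Ideal.map_span, ← Set.range_comp] at hx₀
        obtain ⟨p, hp⟩ := (Submodule.mem_span_range_iff_exists_fun P).1 hx
        have hx' : x = ∑ l, p l • Gk l := Subtype.ext (by simp [Gk, ← hp])
        rw [hx', tmul_sum]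
        refine Submodule.sum_mem _ fun l _ => ?_
        rw [tmul_smul, ← algebraMap_smul K (p l)]
        refine Submodule.smul_mem _ _ ?_
        rw [show c ⊗ₜ[P] Gk l = c • ((1 : K) ⊗ₜ[P] Gk l) by rw [smul_tmul', smul_eq_mul, mul_one]]
        exact Submodule.smul_mem _ _ (Submodule.subset_span ⟨l, rfl⟩)
    rw [injective_iff_map_eq_zero]
    intro z hz
    obtain ⟨c, rfl⟩ := hspan z
    have hT : KaehlerDifferential.cotangentComplexBaseChange k Sₗ P K
        (∑ l, c l • ((1 : K) ⊗ₜ[P] Gk l)) =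
        ∑ l, c l • ((1 : K) ⊗ₜ[P] KaehlerDifferential.D k P (algebraMap P₀ P (g l))) := by
      simp only [map_sum, map_smul, KaehlerDifferential.cotangentComplexBaseChange_tmul, one_smul,
        KaehlerDifferential.kerToTensor_apply, Gk]
    rw [hT] at hz
    have hc : ∀ l₀, c l₀ = 0 := fun l₀ => by
      have := congrArg (ψ l₀) hz
      rw [map_zero, map_sum, Finset.sum_eq_single l₀] at this
      · rw [map_smul, hψ, smul_eq_mul] at this
        exact (mul_eq_zero.1 this).resolve_right (hD' l₀)
      · intro l _ hl
        rw [map_smul, hψ, hD l₀ l (Ne.symm hl), smul_zero]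
      · exact fun h => absurd (Finset.mem_univ l₀) h
    simp [hc]
  -- transfer to the localization of `P₀ ⧸ I` at `𝔶`
  have hsub : Algebra.algebraMapSubmonoid (P₀ ⧸ I) 𝔮.primeCompl = 𝔶.primeCompl := by
    ext s
    constructor
    · rintro ⟨p, hp, rfl⟩
      exact hp
    · intro hs
      obtain ⟨p, rfl⟩ := Ideal.Quotient.mk_surjective s
      exact ⟨p, hs, rfl⟩
  haveI : IsLocalization.AtPrime Sₗ 𝔶 := by
    rw [IsLocalization.AtPrime, ← hsub]
    infer_instance
  let e' : Localization.AtPrime 𝔶 ≃ₐ[P₀ ⧸ I] Sₗ := IsLocalization.algEquiv 𝔶.primeCompl _ _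
  haveI : IsScalarTower k (P₀ ⧸ I) Sₗ := IsScalarTower.of_algebraMap_eq fun x => rfl
  exact Algebra.FormallySmooth.of_equiv (e'.symm.restrictScalars k)

end Jacobian

/-! ## Smoothness of the slice at the good points -/

section Slice

variable {k R κ : Type*} [Field k] [CommRing R] [Algebra k R] [CommRing κ] [Algebra k κ]
  {G : Type*} [AddCommGroup G] [DecidableEq G] (𝓡 : G → Submodule k R) [GradedAlgebra 𝓡]
  (M : Submodule ℤ G) {m : ℕ} (b : Module.Basis (Fin m) ℤ M)
  (u : Fin m → R) (c : Fin m → κ)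

variable (k) in
/-- The generators `1 ⊗ uₗ - cₗ ⊗ 1` of the ideal of the slice. [folklore] -/
def sliceGen (l : Fin m) : κ ⊗[k] R := (1 : κ) ⊗ₜ u l - c l ⊗ₜ (1 : R)

/-- **The slice is smooth at the good points.** With homogeneous units `uₗ` of degrees a
`ℤ`-basis of the lattice `M`, the slice `(κ ⊗ₖ R) ⧸ (1 ⊗ uₗ - cₗ ⊗ 1)ₗ` is smooth over `k` at
every prime containing the `1 ⊗ R_χ` for `χ ∉ M`, provided `κ ⊗ₖ R` is smooth over `k`: the
twisted Euler derivations with weights the coordinate functionals of the basis take the values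
`Dₗ(1 ⊗ uᵢ - cᵢ ⊗ 1) = δₗᵢ uᵢ ≠ 0` at the point. [folklore] -/
theorem isSmoothAt_slice [Algebra.Smooth k (κ ⊗[k] R)] (hu : ∀ l, u l ∈ 𝓡 (b l))
    (hunit : ∀ l, IsUnit (u l))
    (𝔶 : Ideal ((κ ⊗[k] R) ⧸ Ideal.span (Set.range (sliceGen k u c)))) [𝔶.IsPrime]
    (hgood : ∀ χ ∉ M, ∀ r ∈ 𝓡 χ,
      Ideal.Quotient.mk (Ideal.span (Set.range (sliceGen k u c))) ((1 : κ) ⊗ₜ[k] r) ∈ 𝔶) :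
    Algebra.IsSmoothAt k 𝔶 := by
  let 𝔮 := 𝔶.comap (Ideal.Quotient.mk (Ideal.span (Set.range (sliceGen k u c))))
  haveI : 𝔮.IsPrime := Ideal.comap_isPrime _ _
  let K := 𝔮.ResidueField
  have hτ : ∀ χ ∉ M, ∀ r ∈ 𝓡 χ, rightMap k R K κ r = 0 := fun χ hχ r hr => by
    change algebraMap (κ ⊗[k] R) K ((1 : κ) ⊗ₜ r) = 0
    rw [Ideal.algebraMap_residueField_eq_zero]
    exact hgood χ hχ r hr
  let E : Fin m → (R →ₗ[k] K) := fun l =>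
    eulerMap 𝓡 M (b.coord l).toAddMonoidHom (rightMap k R K κ)
  let D : Fin m → Derivation k (κ ⊗[k] R) K := fun l =>
    tensorDerivation (E l) (eulerMap_one _ _ _ _) (eulerMap_mul _ _ _ _ hτ)
  have hval : ∀ l i, D l (sliceGen k u c i) = (b.coord l (b i)) • rightMap k R K κ (u i) := by
    intro l i
    change tensorDerivation (E l) _ _ ((1 : κ) ⊗ₜ u i - c i ⊗ₜ (1 : R)) = _
    rw [tensorDerivation_sub]
    change eulerMap 𝓡 M (b.coord l).toAddMonoidHom (rightMap k R K κ) (u i) = _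
    rw [eulerMap_of_mem 𝓡 M _ _ (hu i), weight_of_mem M _ (b i).2]
    rfl
  refine isSmoothAt_of_derivation (sliceGen k u c) 𝔶 D (fun l i hli => ?_) (fun i => ?_)
  · rw [hval, Module.Basis.coord_apply, Module.Basis.repr_self, Finsupp.single_eq_of_ne hli,
      zero_smul]
  · rw [hval, Module.Basis.coord_apply, Module.Basis.repr_self, Finsupp.single_eq_same, one_smul]
    exact ((hunit i).map (rightMap k R K κ)).ne_zero

end Slice

end Summit.ResolutionOfSingularities.ResolutionOfSingularities.Theorems.DatumToEmbedded.QuotientSingularities
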